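import Summits.CriticalPhenomena.Ising3D.IsingColumnFaceL11CensusRadiiJointCore

/-!
# The catalogue census of §7.3 as kernel facts, XIV-D: kernel evaluations for the JOINT radius of `LIN ∪ TRG` —
window `3` of the merged covering check, part `3` of the `LIN` hole-window check, parts `6`, `7` of the `TRG`
hole-window check (cell `pub-ising3x`, seat recog-1; paper §1.6 / §7.3)

HONEST FRAMING: lottery ticket; floor = tightest certified 3D Ising CFT bounds; no exact-solution claim without a
proof. Island framing: certified exclusion region at stated derivative order and assumptions; not a determination of
the 3D Ising critical exponents beyond that.

Four `decide +kernel` evaluations of the machine of `IsingColumnFaceL11CensusRadiiJointCore.lean` (see its header):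
* `jointCover_p3` — window `3` of `4` of the certified segment in units `linU = 10¹⁸·27720`: the kernel enumerates the
  `LIN` candidates of the window (landed `linWin`; `30766` of them, by the twin), sorts their certified enclosures
  (`msortN`), merges the `31` witness enclosures `jointWit3.map witEnc` (`mergeN`) after checking the witnesses' side
  conditions, and checks the chain with gap constant `jointG` (`zgapsLE`);
* `jointHoleL_part3` — part `3` (`linExcludedPart`, `ExclusionSentencesLin`) of the landed exhaustive `LIN` checker on the
  hole window `[jointHoleA, jointHoleB]` listing the single tuple `jointHoleY`;
* `jointHoleT_part6`, `jointHoleT_part7` — parts `6`, `7` (`trgFullPart`, `ExclusionSentencesTrgGamma`) of the landed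
  exhaustive `TRG` checker on the same window listing the single tuple `jointHoleX`.
Assembled in `…CensusRadiiJoint.lean`. Every Bool was `#eval`-ed `true` before filing (recog-1 gen 57 `EvalAll.lean`).
The heartbeat / recursion options are those of parts VII/VIII (long evaluations, not deep ones). Pure arithmetic;
no certificate, no datum, no σ–ε axiom; nothing is recognised.
lottery ticket; floor = tightest certified 3D Ising CFT bounds; no exact-solution claim without a proof.
-/

namespace Summit.CriticalPhenomena.Ising3D
namespace ColumnFaceL11
open Set Literature.MathematicalPhysics.QuantumFieldTheory.ConformalBootstrap3D

set_option maxHeartbeats 200000000 in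
set_option maxRecDepth 200000 in
/-- JOINT window `3`: start `37752934570312499999999`, end `38642628509797288128120 + jointG` (units `linU`): the witnesses of
`jointWit3` satisfy `trgGTupleOK 17 32`, and along the merged sorted list every enclosure's upper end is within `jointG`
of the running reference point, up to the end. [folklore] -/
theorem jointCover_p3 :
    jointCover jointG 37752934570312499999999 (38642628509797288128120 + jointG) jointWit3 = true := by
  decide +kernel

set_option maxHeartbeats 200000000 in
set_option maxRecDepth 200000 in
/-- Part `3` of the landed `LIN` checker on the hole window lists only `jointHoleY`. [folklore] -/
theorem jointHoleL_part3 : linExcludedPart 12 3 jointHoleA jointHoleB [jointHoleY] = true := by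
  decide +kernel

set_option maxHeartbeats 200000000 in
set_option maxRecDepth 200000 in
/-- Part `6` of the landed `TRG` checker on the hole window lists only `jointHoleX`. [folklore] -/
theorem jointHoleT_part6 : trgFullPart 17 32 6 jointHoleA jointHoleB [jointHoleX] = true := by
  decide +kernel

set_option maxHeartbeats 200000000 in
set_option maxRecDepth 200000 in
/-- Part `7` of the landed `TRG` checker on the hole window lists only `jointHoleX`. [folklore] -/
theorem jointHoleT_part7 : trgFullPart 17 32 7 jointHoleA jointHoleB [jointHoleX] = true := by
  decide +kernel

end ColumnFaceL11
end Summit.CriticalPhenomena.Ising3D
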